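import Summits.Ventures.CertifiedManyBodySolver.Lower.PauliDoublonRealDensity
import HarnessLib

/-!
# Ventures/CertifiedManyBodySolver — Lower/PauliDoublonHalfFilling.lean: the Pauli–doublon floor at half filling in closed form

HONEST FRAMING: first certified bounds; not a superconductivity verdict; every number certified or labelled float.

Part 6 of the Pauli–doublon (doped Langer–Mattis) floor (parts 1–5: `Lower/PauliDoublonBlock.lean`,
`…LevelProj.lean`, `…OperatorIdentity.lean`, `…Floor.lean`, `…RealDensity.lean`), theorem-only. At half filling
`n = 1` (`κ = 1/2`) with the admissible choice `α = -U/4`, `ν = 0` the block floor is smooth and explicit,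
`s̃(ε; U, 1/2, -U/4, 0) = (√(ε² + (U/4)²) − ε)/2` for EVERY real `ε` (`blockFloor_halfFilling`; no positive part is
active), the odd part `∫_BZ (cos p₀ + cos p₁) dp` vanishes by the Brillouin-zone sign flip
(`integral_brillouin_two_sum_cos_eq_zero`), and THEOREM E (`tlBound_holds`) specialises to

  `e(t, U, 1) ≥ U/4 − (2π)⁻² ∫_{[-π,π]²} √((2t(cos p₀ + cos p₁))² + (U/4)²) dp`   (`tlBound_halfFilling`),

which is VERBATIM the Langer–Mattis bound of the tree at `n = 1`
(`Literature.MathematicalPhysics.QuantumLattice.LangerMattis.energyDensity2D_ge`, integrand `lmIntegrand`,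
[cite: LangerMattis1971, eqs. (3)–(5)]) — recorded as the identity `tlBound_halfFilling_eq_langerMattis` of the two
right-hand sides. So at half filling the PDB-L family CONTAINS the printed Langer–Mattis bound (and is first-order exact
in `U`); off half filling it is a kernel theorem of the printed class [cite: ValentiStolzeHirschfeld1991, bound type (b)]
(Falicov–Kimball input unread), not a result new in print. Mathematics and Lean proofs: hubbard-alg L3 seat B
(planner-sr-mbsolver-l3-idea-2 g26, `PauliDoublonSketch.lean` v11 sha16 24852083496c0d24, `HalfFilling-addon.lean.txt`
sha16 eb35af4fcc0576b4, NOTE-PDB-L §6.10); tree placement, the Langer–Mattis identification and citations: LIT lane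
(literature-prover lit-1 g22). 0 sorry, 0 new definitions.
-/

noncomputable section

namespace Summit.Ventures.CertifiedManyBodySolver.Lower

namespace PauliDoublon

open Literature.MathematicalPhysics.QuantumLattice
open Matrix Finset Filter Literature.Probability.LatticeModels ThermodynamicLimit LangerMattis MeasureTheory
open scoped Topology ComplexOrder

/-! ### Half filling: the closed form (NOTE-PDB-L §6.10) -/

/-- Closed form of the block floor from its two scalar invariants: if the discriminant under the square root
equals `(S/2)²` (`S ≥ 0`), the mean level is `ε/2` and `-S ≤ ε ≤ S`, then `blockFloor ε U κ α ν = (S − ε)/2`.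
[folklore] -/
theorem blockFloor_eq_of_invariants (ε U κ α ν S : ℝ) (hS0 : 0 ≤ S)
    (hrad : ((1 - κ) * (ε + α) - κ * (ε + α + U / 2)) ^ 2 / 4 + (1 - κ) * κ * (ε + ν) ^ 2 =
      (S / 2) ^ 2)
    (hhalf : ((1 - κ) * (ε + α) + κ * (ε + α + U / 2)) / 2 = ε / 2)
    (h1 : -S ≤ ε) (h2 : ε ≤ S) :
    blockFloor ε U κ α ν = (S - ε) / 2 := by
  unfold blockFloor
  dsimp only
  rw [hrad, Real.sqrt_sq (by linarith), hhalf, max_eq_right (by linarith),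
    max_eq_left (by linarith)]
  ring

/-- **Half filling, `α = -U/4`, `ν = 0`:** `s̃(ε; U, 1/2, -U/4, 0) = (√(ε² + (U/4)²) − ε)/2` for every real `ε`.
[folklore] -/
theorem blockFloor_halfFilling (ε U : ℝ) :
    blockFloor ε U (1 / 2) (-(U / 4)) 0 = (Real.sqrt (ε ^ 2 + (U / 4) ^ 2) - ε) / 2 := by
  have habs : |ε| ≤ Real.sqrt (ε ^ 2 + (U / 4) ^ 2) :=
    Real.abs_le_sqrt (by nlinarith [sq_nonneg (U / 4)])
  have h1 : -Real.sqrt (ε ^ 2 + (U / 4) ^ 2) ≤ ε := by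
    have := neg_abs_le ε; linarith
  have h2 : ε ≤ Real.sqrt (ε ^ 2 + (U / 4) ^ 2) := le_trans (le_abs_self ε) habs
  refine blockFloor_eq_of_invariants ε U (1 / 2) (-(U / 4)) 0 _ (Real.sqrt_nonneg _) ?_ (by ring) h1 h2
  rw [div_pow, Real.sq_sqrt (by positivity)]
  ring

/-- `∫_{[-π,π]²} (cos p₀ + cos p₁) dp = 0` (from the Brillouin-zone sign flip
`integral_brillouin_two_sum_cos_neg`). [folklore] -/
theorem integral_brillouin_two_sum_cos_eq_zero :
    ∫ p in brillouin 2, (∑ i, Real.cos (p i)) = 0 := by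
  have h := integral_brillouin_two_sum_cos_neg (fun c : ℝ => c) continuous_id
  rw [MeasureTheory.integral_neg] at h
  linarith

/-- **PDB-L at half filling in closed form (the SDW-mirror lower bound).** For every hopping `t`
and every `U ≥ 0`: `U/4 − (2π)⁻² ∫_{[-π,π]²} √((2t(cos p₀ + cos p₁))² + (U/4)²) dp ≤ e(t, U, 1)`
(`e = energyDensity2D`). Specialisation of `tlBound_holds` at `n = 1`, `α = -U/4`, `ν = 0` through
`blockFloor_halfFilling` and `integral_brillouin_two_sum_cos_eq_zero`. The right-hand side is the printed
Langer–Mattis bound at half filling [cite: LangerMattis1971, eqs. (3)–(5)] — see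
`tlBound_halfFilling_eq_langerMattis`. -/
theorem tlBound_halfFilling (t U : ℝ) (hU : 0 ≤ U) :
    U / 4 - ((2 * Real.pi) ^ 2)⁻¹ *
        ∫ p in brillouin 2, Real.sqrt ((t * (2 * ∑ i, Real.cos (p i))) ^ 2 + (U / 4) ^ 2) ≤
      energyDensity2D t U 1 := by
  have h := tlBound_holds t U hU 1 (by norm_num) (by norm_num) (-(U / 4)) 0
  have hpt : ∀ p : Fin 2 → ℝ, pdbIntegrand t U (1 / 2) (-(U / 4)) 0 p =
      (1 / 2) * Real.sqrt ((t * (2 * ∑ i, Real.cos (p i))) ^ 2 + (U / 4) ^ 2) +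
        t * ∑ i, Real.cos (p i) := by
    intro p
    simp only [pdbIntegrand]
    rw [blockFloor_halfFilling, neg_sq]
    ring
  have hc1 : Continuous fun p : Fin 2 → ℝ =>
      (1 / 2 : ℝ) * Real.sqrt ((t * (2 * ∑ i, Real.cos (p i))) ^ 2 + (U / 4) ^ 2) := by
    fun_prop
  have hc2 : Continuous fun p : Fin 2 → ℝ => t * ∑ i, Real.cos (p i) := by fun_prop
  have hI : ∫ p in brillouin 2, pdbIntegrand t U (1 / 2) (-(U / 4)) 0 p =
      (1 / 2) * ∫ p in brillouin 2, Real.sqrt ((t * (2 * ∑ i, Real.cos (p i))) ^ 2 + (U / 4) ^ 2) := by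
    rw [MeasureTheory.setIntegral_congr_fun (measurableSet_brillouin 2) (fun p _ => hpt p),
      MeasureTheory.integral_add (hc1.continuousOn.integrableOn_compact (isCompact_brillouin 2))
        (hc2.continuousOn.integrableOn_compact (isCompact_brillouin 2)),
      MeasureTheory.integral_const_mul, MeasureTheory.integral_const_mul,
      integral_brillouin_two_sum_cos_eq_zero, mul_zero, add_zero]
  rw [hI] at h
  have key : -(2 * (-(U / 4) * (1 / 2) + ((2 * Real.pi) ^ 2)⁻¹ *
      ((1 / 2) * ∫ p in brillouin 2, Real.sqrt ((t * (2 * ∑ i, Real.cos (p i))) ^ 2 + (U / 4) ^ 2)))) =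
      U / 4 - ((2 * Real.pi) ^ 2)⁻¹ *
        ∫ p in brillouin 2, Real.sqrt ((t * (2 * ∑ i, Real.cos (p i))) ^ 2 + (U / 4) ^ 2) := by
    ring
  rw [key] at h
  exact h

/-! ### Identification with the printed Langer–Mattis bound at `n = 1` -/

/-- **At half filling PDB-L (`α = -U/4`, `ν = 0`) IS the Langer–Mattis bound.** The right-hand side of
`tlBound_halfFilling` equals the right-hand side `(U/2)·1 − U/4 − (2π)⁻² ∫_BZ lmIntegrand t U` of the tree's
thermodynamic-limit Langer–Mattis theorem `LangerMattis.energyDensity2D_ge` at `n = 1`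
(`lmIntegrand t U p = √((2t Σ_i cos p_i)² + (U/4)²)`, [cite: LangerMattis1971, eqs. (3)–(5)]). -/
theorem tlBound_halfFilling_eq_langerMattis (t U : ℝ) :
    U / 4 - ((2 * Real.pi) ^ 2)⁻¹ *
        ∫ p in brillouin 2, Real.sqrt ((t * (2 * ∑ i, Real.cos (p i))) ^ 2 + (U / 4) ^ 2) =
      U / 2 * 1 - U / 4 - ((2 * Real.pi) ^ 2)⁻¹ * ∫ p in brillouin 2, lmIntegrand t U p := by
  simp only [lmIntegrand]
  ring

/-- The Langer–Mattis bound at half filling, re-derived through the Pauli–doublon floor (consistency check of the two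
routes: `LangerMattis.energyDensity2D_ge` at `n = 1` and `tlBound_halfFilling` state the same inequality). [folklore] -/
theorem langerMattis_halfFilling_via_pdbl (t U : ℝ) (hU : 0 ≤ U) :
    U / 2 * 1 - U / 4 - ((2 * Real.pi) ^ 2)⁻¹ * ∫ p in brillouin 2, lmIntegrand t U p ≤
      energyDensity2D t U 1 := by
  rw [← tlBound_halfFilling_eq_langerMattis]
  exact tlBound_halfFilling t U hU

end PauliDoublon

end Summit.Ventures.CertifiedManyBodySolver.Lower
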